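import Literature.NumberTheory.LFunctions.KeiperPowerSeries
import HarnessLib

/-!
# Keiper 1992, *Power series expansions of Riemann's ξ function* — discharges (second prover)

LINE 1 — FRAMING: RH-FREE literature.  Cell rh-crit, corpus C2/dbl, row «dbl:W2-Ke92» support
(typer dbl-t6; this file = second prover, facts disjoint from the typer's own discharge list);
bears_on: L-C/L-P (COLUMN 4, Li).  WHAT THIS IS NOT: any claim about RH — nothing here bears on the
truth of the Riemann Hypothesis.

Discharges of named facts of `KeiperPowerSeries.lean` (J. B. Keiper, Math. Comp. 58 (1992) 765–773),
theorems only, no definitions, no named facts: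

* `Keiper1992_eq45_holds` — eq. (45) p.771, the negative-binomial series
  `Σ_{n≥j} C(n−1, j−1) x^{−n} = (x − 1)^{−j}` for `|x| > 1`, from Mathlib's
  `hasSum_choose_mul_geometric_of_norm_lt_one` at `r = 1/x`.
* `Keiper1992_eq43_holds` — eq. (43) p.770, `Σ_{n≥2} (ζ(n) − 1)/(n 2ⁿ) = (1 − γ)/2 + log(√π/2)`,
  Keiper's own proof: expand `ζ(n) − 1 = Σ_{m≥2} m^{−n}`, swap the (nonnegative) double sum,
  sum each column `Σ_{n≥2} yⁿ/n = −log(1 − y) − y` at `y = 1/(2m)`, and evaluate the resulting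
  telescoping series with Wallis' product and `H_K − log K → γ` (namespace `Keiper43`).
* `Keiper1992_eq9_holds` — eqs. (9)–(10) p.766, `1/(2ξ(s)) = Σ_{n≥0} a_n (s − 1)^n` near `s = 1`
  (in fact on `|s − 1| < 2`, where `ξ ≠ 0`) with `a_n = keiperInvCoeff n`: the Taylor series of the
  holomorphic `1/(2ξ)` (Mathlib `Complex.hasSum_taylorSeries_on_ball`), whose coefficients obey the
  recursion (10) by the Leibniz rule applied to `2ξ · (1/(2ξ)) = 1` (namespace `Keiper9`).
* `Keiper1992_eq33_holds` — eq. (33) p.768 (`m ≥ 2`), `τ_{m−1} = −Σ_ρ m(ρ) (ρ/(ρ−1))^m ρ^{−2}`: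
  the family is absolutely summable (`|ρ/(ρ−1)| ≤ 2`, tree `FordL33.summable_order_div_norm_sq`);
  with `w = ρ/(ρ−1)`, `−w^m ρ^{−2} = (1 − w^m) − 2(1 − w^{m−1}) + (1 − w^{m−2})`, so the real part
  sums to `mλ_m − 2(m−1)λ_{m−1} + (m−2)λ_{m−2} = τ_{m−1}` by (34)–(35) (tree `Keiper1992_eq34`,
  `Keiper1992_eq35`: «τ_m is just the second central difference of mλ_m»), and the sum is real by
  conjugation symmetry of the zeros (namespace `Keiper33`).
* `Keiper1992_eq36_holds` — eq. (36) p.769, RH ⟹ `|τ_k| ≤ Σ_ρ m(ρ)/|ρ|²`: for `k ≥ 1` from (33)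
  and `|ρ/(ρ−1)| = 1` on the critical line; `k = 0` RH-free from `τ₀ = σ₁ = Σ_ρ m(ρ) Re ρ/|ρ|²`
  (namespace `Keiper36`).

## References
* J. B. Keiper, *Power series expansions of Riemann's ξ function*, Math. Comp. 58 (1992) 765–773. [Keiper1992]
-/

noncomputable section

open Filter Topology Finset Real
open scoped Nat ComplexConjugate

namespace Literature.NumberTheory.LFunctions

/-- **DISCHARGE of `Keiper1992_eq45`** — [Keiper1992] (45) p.771: for `j ≥ 1` and `|x| > 1`,
`Σ_{i≥0} C(i+j−1, j−1) x^{−(i+j)} = (x − 1)^{−j}` (the negative-binomial series at `r = 1/x`,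
`Σ_i C(i+k, k) rⁱ = (1 − r)^{−(k+1)}`, times `r^{k+1}`). [cite: Keiper1992, eq. (45) p.771] -/
theorem Keiper1992_eq45_holds : Keiper1992_eq45 := by
  intro j hj x hx
  have hx0 : x ≠ 0 := by
    rintro rfl
    norm_num at hx
  have hx1 : x - 1 ≠ 0 := by
    intro h
    have : x = 1 := by linear_combination h
    rw [this] at hx
    simp at hx
  set r : ℂ := x⁻¹ with hr
  have hr1 : ‖r‖ < 1 := by
    rw [hr, norm_inv]
    exact inv_lt_one_of_one_lt₀ hx
  obtain ⟨k, rfl⟩ : ∃ k, j = k + 1 := ⟨j - 1, by omega⟩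
  have h := (hasSum_choose_mul_geometric_of_norm_lt_one k hr1).mul_left (r ^ (k + 1))
  have hfun : (fun i : ℕ ↦ (((i + (k + 1) - 1).choose (k + 1 - 1) : ℕ) : ℂ) * (x ^ (i + (k + 1)))⁻¹) =
      fun i : ℕ ↦ r ^ (k + 1) * (((i + k).choose k : ℕ) * r ^ i) := by
    funext i
    rw [show i + (k + 1) - 1 = i + k by omega, show k + 1 - 1 = k by omega, hr]
    ring
  have hval : ((x - 1) ^ (k + 1))⁻¹ = r ^ (k + 1) * (1 / (1 - r) ^ (k + 1)) := by
    have e1 : (1 : ℂ) - r = (x - 1) * r := by rw [hr, sub_mul, mul_inv_cancel₀ hx0, one_mul]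
    have hr0' : r ≠ 0 := by rw [hr]; exact inv_ne_zero hx0
    have e2 : r / (1 - r) = (x - 1)⁻¹ := by rw [e1, div_mul_cancel_right₀ hr0']
    calc ((x - 1) ^ (k + 1))⁻¹ = ((x - 1)⁻¹) ^ (k + 1) := by rw [inv_pow]
      _ = (r / (1 - r)) ^ (k + 1) := by rw [e2]
      _ = r ^ (k + 1) * (1 / (1 - r) ^ (k + 1)) := by rw [div_pow, div_eq_mul_one_div]
  rw [hfun, hval]
  exact h


/-! ## [Keiper1992] (43): `Σ_{n≥2} (ζ(n) − 1)/(n 2ⁿ) = (1 − γ)/2 + log(√π/2)` -/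

namespace Keiper43

/-- The inner logarithmic series from `n = 2` on: for `0 ≤ y < 1`, `Σ_{i≥0} y^{i+2}/(i+2) = −log(1−y) − y`.
[cite: Keiper1992, eq. (43) p.770] -/
theorem hasSum_pow_div_two {y : ℝ} (hy0 : 0 ≤ y) (hy1 : y < 1) :
    HasSum (fun i : ℕ ↦ y ^ (i + 2) / ((i : ℝ) + 2)) (-Real.log (1 - y) - y) := by
  have h := Real.hasSum_pow_div_log_of_abs_lt_one (x := y) (by rw [abs_lt]; constructor <;> linarith)
  have h2 := (hasSum_nat_add_iff' (f := fun n : ℕ ↦ y ^ (n + 1) / ((n : ℝ) + 1)) 1).2 h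
  simp only [Finset.sum_range_one, Nat.cast_zero, zero_add, pow_one, div_one] at h2
  have e : (fun i : ℕ ↦ y ^ (i + 2) / ((i : ℝ) + 2)) = fun n : ℕ ↦ y ^ (n + 1 + 1) / (((n + 1 : ℕ) : ℝ) + 1) := by
    funext i
    push_cast
    ring_nf
  rw [e]
  exact h2

/-- The terms `g(m) = −log(1 − 1/(2m)) − 1/(2m)` (`m ≥ 2`) are nonnegative. [cite: Keiper1992, eq. (43) p.770] -/
theorem g_nonneg (m' : ℕ) :
    0 ≤ -Real.log (1 - 1 / (2 * ((m' : ℝ) + 2))) - 1 / (2 * ((m' : ℝ) + 2)) := by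
  have hpos : 0 < 1 - 1 / (2 * ((m' : ℝ) + 2)) := by
    have : 1 / (2 * ((m' : ℝ) + 2)) ≤ 1 / 4 := by
      rw [div_le_div_iff₀ (by positivity) (by norm_num)]
      have : (0 : ℝ) ≤ m' := Nat.cast_nonneg _
      linarith
    linarith
  have := Real.log_le_sub_one_of_pos hpos
  linarith

/-- Wallis' product in the form `(∏_{i<N} (2i+2)/(2i+1))² = W(N)·(2N+1)`. [cite: Keiper1992, eq. (43) p.770] -/
theorem prod_sq_eq_W (N : ℕ) :
    (∏ i ∈ Finset.range N, ((2 * (i : ℝ) + 2) / (2 * i + 1))) ^ 2 = Real.Wallis.W N * (2 * N + 1) := by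
  induction N with
  | zero => simp [Real.Wallis.W]
  | succ N ih =>
    rw [Finset.prod_range_succ, Real.Wallis.W_succ, mul_pow, ih]
    have h1 : (2 * (N : ℝ) + 1) ≠ 0 := by positivity
    have h3 : (2 * (N : ℝ) + 3) ≠ 0 := by positivity
    push_cast
    field_simp
    ring

/-- The partial sums of `g`: `Σ_{m'<K} [log((2m'+4)/(2m'+3)) − 1/(2m'+4)]
= log ∏_{i<K+1}(2i+2)/(2i+1) − log 2 − (H_{K+1} − 1)/2`. [cite: Keiper1992, eq. (43) p.770] -/
theorem partial_sum_eq (K : ℕ) :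
    ∑ m' ∈ Finset.range K, (-Real.log (1 - 1 / (2 * ((m' : ℝ) + 2))) - 1 / (2 * ((m' : ℝ) + 2))) =
      Real.log (∏ i ∈ Finset.range (K + 1), ((2 * (i : ℝ) + 2) / (2 * i + 1))) - Real.log 2
        - ((harmonic (K + 1) : ℝ) - 1) / 2 := by
  induction K with
  | zero =>
    simp [harmonic_succ]
  | succ K ih =>
    rw [Finset.sum_range_succ, ih, Finset.prod_range_succ _ (K + 1), harmonic_succ (K + 1),
      Real.log_mul (Finset.prod_pos fun i _ => by positivity).ne' (by positivity)]
    have e0 : (1 : ℝ) - 1 / (2 * ((K : ℝ) + 2)) =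
        ((2 * ((K + 1 : ℕ) : ℝ) + 2) / (2 * ((K + 1 : ℕ) : ℝ) + 1))⁻¹ := by
      have h3 : (2 * (K : ℝ) + 3) ≠ 0 := by positivity
      have h4 : (2 * (K : ℝ) + 4) ≠ 0 := by positivity
      have h2 : ((K : ℝ) + 2) ≠ 0 := by positivity
      push_cast
      rw [inv_div]
      field_simp
      ring
    have e1 : -Real.log (1 - 1 / (2 * ((K : ℝ) + 2))) =
        Real.log ((2 * ((K + 1 : ℕ) : ℝ) + 2) / (2 * ((K + 1 : ℕ) : ℝ) + 1)) := by
      rw [e0, Real.log_inv, neg_neg]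
    rw [e1]
    have h2 : ((K : ℝ) + 2) ≠ 0 := by positivity
    push_cast
    field_simp
    ring

/-- `Σ_{m≥2} [−log(1 − 1/(2m)) − 1/(2m)] = (1 − γ)/2 + log(√π/2)` (Wallis + Euler–Mascheroni).
[cite: Keiper1992, eq. (43) p.770] -/
theorem hasSum_g :
    HasSum (fun m' : ℕ ↦ -Real.log (1 - 1 / (2 * ((m' : ℝ) + 2))) - 1 / (2 * ((m' : ℝ) + 2)))
      ((1 - Real.eulerMascheroniConstant) / 2 + Real.log (√π / 2)) := by
  refine (hasSum_iff_tendsto_nat_of_nonneg g_nonneg _).2 ?_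
  simp_rw [partial_sum_eq]
  -- log ∏ = (log W(K+1) + log(2K+3))/2
  have hlogQ : ∀ K : ℕ, Real.log (∏ i ∈ Finset.range (K + 1), ((2 * (i : ℝ) + 2) / (2 * i + 1))) =
      (Real.log (Real.Wallis.W (K + 1)) + Real.log (2 * ((K + 1 : ℕ) : ℝ) + 1)) / 2 := by
    intro K
    have hQ : 0 < ∏ i ∈ Finset.range (K + 1), ((2 * (i : ℝ) + 2) / (2 * i + 1)) :=
      Finset.prod_pos fun i _ => by positivity
    have h := prod_sq_eq_W (K + 1)
    have h2 : Real.log ((∏ i ∈ Finset.range (K + 1), ((2 * (i : ℝ) + 2) / (2 * i + 1))) ^ 2) =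
        Real.log (Real.Wallis.W (K + 1)) + Real.log (2 * ((K + 1 : ℕ) : ℝ) + 1) := by
      rw [h, Real.log_mul (Real.Wallis.W_pos _).ne' (by positivity)]
    rw [Real.log_pow] at h2
    push_cast at h2 ⊢
    linarith
  simp_rw [hlogQ]
  -- the three limits
  have l1 : Tendsto (fun K : ℕ ↦ Real.log (Real.Wallis.W (K + 1))) atTop (𝓝 (Real.log (π / 2))) :=
    ((Real.continuousAt_log (by positivity)).tendsto.comp Real.Wallis.tendsto_W_nhds_pi_div_two).comp
      (tendsto_add_atTop_nat 1)
  have l2 : Tendsto (fun K : ℕ ↦ Real.log (2 * ((K + 1 : ℕ) : ℝ) + 1) - Real.log ((K + 1 : ℕ) : ℝ))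
      atTop (𝓝 (Real.log 2)) := by
    have h : Tendsto (fun K : ℕ ↦ Real.log ((2 * ((K + 1 : ℕ) : ℝ) + 1) / ((K + 1 : ℕ) : ℝ)))
        atTop (𝓝 (Real.log 2)) := by
      apply ((Real.continuousAt_log (by norm_num : (2:ℝ) ≠ 0)).tendsto.comp)
      have : Tendsto (fun K : ℕ ↦ 2 + 1 / ((K : ℝ) + 1)) atTop (𝓝 (2 + 0)) :=
        tendsto_const_nhds.add tendsto_one_div_add_atTop_nhds_zero_nat
      rw [add_zero] at this
      refine this.congr fun K => ?_
      have : ((K : ℝ) + 1) ≠ 0 := by positivity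
      push_cast
      field_simp
    refine h.congr fun K => ?_
    rw [Real.log_div (by positivity) (by positivity)]
  have l3 : Tendsto (fun K : ℕ ↦ (harmonic (K + 1) : ℝ) - Real.log ((K + 1 : ℕ) : ℝ)) atTop
      (𝓝 Real.eulerMascheroniConstant) := by
    have h := Real.tendsto_eulerMascheroniSeq'.comp (tendsto_add_atTop_nat 1)
    refine h.congr fun K => ?_
    simp [Function.comp, Real.eulerMascheroniSeq']
  have lim := ((l1.add l2).sub l3)
  have e : ∀ K : ℕ,
      (Real.log (Real.Wallis.W (K + 1)) + Real.log (2 * ((K + 1 : ℕ) : ℝ) + 1)) / 2 - Real.log 2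
          - ((harmonic (K + 1) : ℝ) - 1) / 2 =
        (Real.log (Real.Wallis.W (K + 1)) + (Real.log (2 * ((K + 1 : ℕ) : ℝ) + 1) - Real.log ((K + 1 : ℕ) : ℝ))
          - ((harmonic (K + 1) : ℝ) - Real.log ((K + 1 : ℕ) : ℝ))) / 2 - Real.log 2 + 1 / 2 := by
    intro K; ring
  simp_rw [e]
  have lim2 := ((lim.div_const 2).sub_const (Real.log 2)).add_const (1 / 2)
  convert lim2 using 2
  have hπ : 0 < π := Real.pi_pos
  rw [Real.log_div (Real.sqrt_pos.2 hπ).ne' two_ne_zero, Real.log_sqrt hπ.le,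
    Real.log_div hπ.ne' two_ne_zero]
  ring


/-- The nonnegative double family `F(m', i) = (1/(2(m'+2)))^{i+2}/(i+2)` (`m = m'+2 ≥ 2`, `n = i+2 ≥ 2`)
has sum `(1 − γ)/2 + log(√π/2)` (Tonelli: rows first). [cite: Keiper1992, eq. (43) p.770] -/
theorem hasSum_F :
    HasSum (fun p : ℕ × ℕ ↦ (1 / (2 * ((p.1 : ℝ) + 2))) ^ (p.2 + 2) / ((p.2 : ℝ) + 2))
      ((1 - Real.eulerMascheroniConstant) / 2 + Real.log (√π / 2)) := by
  have hnn : 0 ≤ fun p : ℕ × ℕ ↦ (1 / (2 * ((p.1 : ℝ) + 2))) ^ (p.2 + 2) / ((p.2 : ℝ) + 2) :=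
    fun p => by positivity
  have hy : ∀ m' : ℕ, 0 ≤ 1 / (2 * ((m' : ℝ) + 2)) ∧ 1 / (2 * ((m' : ℝ) + 2)) < 1 := by
    intro m'
    refine ⟨by positivity, ?_⟩
    rw [div_lt_one (by positivity)]
    have : (0 : ℝ) ≤ m' := Nat.cast_nonneg _
    linarith
  have hslice : ∀ m' : ℕ, HasSum (fun i : ℕ ↦ (1 / (2 * ((m' : ℝ) + 2))) ^ (i + 2) / ((i : ℝ) + 2))
      (-Real.log (1 - 1 / (2 * ((m' : ℝ) + 2))) - 1 / (2 * ((m' : ℝ) + 2))) :=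
    fun m' => hasSum_pow_div_two (hy m').1 (hy m').2
  have hsum : Summable (fun p : ℕ × ℕ ↦ (1 / (2 * ((p.1 : ℝ) + 2))) ^ (p.2 + 2) / ((p.2 : ℝ) + 2)) := by
    rw [summable_prod_of_nonneg hnn]
    refine ⟨fun m' => (hslice m').summable, ?_⟩
    have e : (fun m' : ℕ ↦ ∑' i : ℕ, (1 / (2 * ((m' : ℝ) + 2))) ^ (i + 2) / ((i : ℝ) + 2)) =
        fun m' : ℕ ↦ -Real.log (1 - 1 / (2 * ((m' : ℝ) + 2))) - 1 / (2 * ((m' : ℝ) + 2)) :=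
      funext fun m' => (hslice m').tsum_eq
    simp only
    rw [e]
    exact hasSum_g.summable
  have h1 := hsum.hasSum
  have h2 := h1.prod_fiberwise hslice
  rwa [h2.unique hasSum_g] at h1

/-- `ζ(n) − 1 = Σ_{m'≥0} (m'+2)^{−n}` for `n ≥ 2` (Mathlib `zeta_nat_eq_tsum_of_gt_one` minus the terms
`m = 0, 1`). [cite: Keiper1992, eq. (43) p.770] -/
theorem hasSum_zeta_nat_sub_one {n : ℕ} (hn : 2 ≤ n) :
    HasSum (fun m' : ℕ ↦ 1 / ((m' : ℂ) + 2) ^ n) (riemannZeta n - 1) := by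
  have hz := zeta_nat_eq_tsum_of_gt_one (k := n) (by omega)
  have hsR : Summable (fun m : ℕ ↦ 1 / (m : ℝ) ^ n) := Real.summable_one_div_nat_pow.2 (by omega)
  have hsC : Summable (fun m : ℕ ↦ 1 / (m : ℂ) ^ n) := by
    have := Complex.summable_ofReal.2 hsR
    refine this.congr fun m => ?_
    push_cast
    rfl
  have h1 : HasSum (fun m : ℕ ↦ 1 / (m : ℂ) ^ n) (riemannZeta n) := by rw [hz]; exact hsC.hasSum
  have h2 := (hasSum_nat_add_iff' (f := fun m : ℕ ↦ 1 / (m : ℂ) ^ n) 2).2 h1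
  have h0 : (0 : ℂ) ^ n = 0 := zero_pow (by omega)
  simp only [Finset.sum_range_succ, Finset.sum_range_zero, Nat.cast_zero, h0, div_zero, zero_add,
    Nat.cast_one, one_pow, div_one] at h2
  refine (h2.congr_fun fun m' => ?_)
  push_cast
  rfl

/-- The `i`-th term of (43) as the `i`-th column sum of `F`:
`(ζ(i+2) − 1)/((i+2)2^{i+2}) = Σ_{m'} (1/(2(m'+2)))^{i+2}/(i+2)`. [cite: Keiper1992, eq. (43) p.770] -/
theorem term_eq (i : ℕ) :
    (riemannZeta (i + 2) - 1) / ((i + 2) * 2 ^ (i + 2)) =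
      ((∑' m' : ℕ, (1 / (2 * ((m' : ℝ) + 2))) ^ (i + 2) / ((i : ℝ) + 2) : ℝ) : ℂ) := by
  have h := (hasSum_zeta_nat_sub_one (n := i + 2) (by omega)).div_const (((i : ℂ) + 2) * 2 ^ (i + 2))
  push_cast at h
  rw [Complex.ofReal_tsum, ← h.tsum_eq]
  refine tsum_congr fun m' => ?_
  push_cast
  rw [div_pow, mul_pow, one_pow]
  generalize ((m' : ℂ) + 2) = A
  generalize ((i : ℂ) + 2) = B
  rw [div_div, div_div]
  ring

end Keiper43

/-- **DISCHARGE of `Keiper1992_eq43`** — [Keiper1992] (43) p.770: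
`Σ_{n≥2} (ζ(n) − 1)/(n 2ⁿ) = (1 − γ)/2 + log(√π/2)`.  Proof: `ζ(n) − 1 = Σ_{m≥2} m^{−n}`, Tonelli,
`Σ_{n≥2} (1/2m)ⁿ/n = −log(1 − 1/2m) − 1/2m`, and `Σ_{m≥2}` of these `= (1−γ)/2 + log(√π/2)` by Wallis'
product `(∏_{i<N}(2i+2)/(2i+1))² = W(N)(2N+1) → ∞·(π/2)` and `H_N − log N → γ`.
[cite: Keiper1992, eq. (43) p.770] -/
theorem Keiper1992_eq43_holds : Keiper1992_eq43 := by
  have hF := Keiper43.hasSum_F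
  have hF' : HasSum (fun p : ℕ × ℕ ↦ (1 / (2 * ((p.2 : ℝ) + 2))) ^ (p.1 + 2) / ((p.1 : ℝ) + 2))
      ((1 - Real.eulerMascheroniConstant) / 2 + Real.log (√π / 2)) :=
    (Equiv.hasSum_iff (Equiv.prodComm ℕ ℕ)).2 hF
  have ht : HasSum (fun i : ℕ ↦ ∑' m' : ℕ, (1 / (2 * ((m' : ℝ) + 2))) ^ (i + 2) / ((i : ℝ) + 2))
      ((1 - Real.eulerMascheroniConstant) / 2 + Real.log (√π / 2)) :=
    hF'.prod_fiberwise fun i => (hF'.summable.prod_factor i).hasSum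
  have hC := Complex.hasSum_ofReal.2 ht
  show HasSum _ _
  convert hC using 1
  funext i
  exact Keiper43.term_eq i


/-! ## (9)–(10) p.766: the reciprocal series `1/(2ξ(s)) = Σ a_n (s − 1)^n` -/

namespace Keiper9

/-- `1/(2ξ)` is holomorphic on `|s − 1| < 2` (`ξ ≠ 0` there, tree
`riemannXi_ne_zero_of_mem_ball_one_two`). [cite: Keiper1992, eq. (9) p.766] -/
theorem differentiableOn_inv_two_xi :
    DifferentiableOn ℂ (fun s : ℂ ↦ 1 / (2 * riemannXi s)) (Metric.ball (1 : ℂ) 2) := by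
  intro s hs
  have h2 : (2 : ℂ) * riemannXi s ≠ 0 :=
    mul_ne_zero two_ne_zero (riemannXi_ne_zero_of_mem_ball_one_two hs)
  exact ((differentiableAt_const _).div (((differentiable_riemannXi.const_mul (2 : ℂ)) s))
    h2).differentiableWithinAt

/-- The Leibniz relation behind (10): for `n ≥ 1`, the Taylor coefficients
`c_m = (1/(2ξ))^{(m)}(1)/m!` of `1/(2ξ)` at `1` satisfy `Σ_{i=0}^{n} α_i c_{n−i} = 0`
(«examining the product of the expansions of `2ξ(s)` and `1/(2ξ(s))`»).
[cite: Keiper1992, eqs. (9)–(10) p.766] -/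
theorem sum_alpha_mul_coeff_eq_zero {n : ℕ} (hn : 1 ≤ n) :
    ∑ i ∈ range (n + 1), (keiperAlpha i : ℂ) *
      (iteratedDeriv (n - i) (fun s : ℂ ↦ 1 / (2 * riemannXi s)) 1 / ((n - i)! : ℂ)) = 0 := by
  set f : ℂ → ℂ := fun s ↦ 2 * riemannXi s with hf_def
  set g : ℂ → ℂ := fun s ↦ 1 / (2 * riemannXi s) with hg_def
  have hball : Metric.ball (1 : ℂ) 2 ∈ 𝓝 (1 : ℂ) := Metric.ball_mem_nhds _ (by norm_num)
  have hf : ContDiffAt ℂ n f 1 :=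
    (((differentiable_riemannXi.const_mul (2 : ℂ))).analyticAt 1).contDiffAt
  have hg : ContDiffAt ℂ n g 1 := (differentiableOn_inv_two_xi.analyticAt hball).contDiffAt
  -- `f * g = 1` near `1`
  have hfg : f * g =ᶠ[𝓝 (1 : ℂ)] fun _ ↦ (1 : ℂ) := by
    filter_upwards [hball] with s hs
    have h2 : (2 : ℂ) * riemannXi s ≠ 0 :=
      mul_ne_zero two_ne_zero (riemannXi_ne_zero_of_mem_ball_one_two hs)
    simp only [Pi.mul_apply, hf_def, hg_def]
    exact mul_one_div_cancel h2
  have hL := iteratedDeriv_mul hf hg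
  rw [hfg.iteratedDeriv_eq n, iteratedDeriv_const, if_neg (by omega)] at hL
  -- divide the Leibniz sum by `n!`
  have hfac : ∀ i ∈ range (n + 1),
      (n.choose i : ℂ) * iteratedDeriv i f 1 * iteratedDeriv (n - i) g 1 =
        (n ! : ℂ) * ((keiperAlpha i : ℂ) * (iteratedDeriv (n - i) g 1 / ((n - i)! : ℂ))) := by
    intro i hi
    have hi' : i ≤ n := Nat.lt_succ_iff.1 (mem_range.1 hi)
    have hchoose : (n.choose i : ℂ) * (i ! : ℂ) * ((n - i)! : ℂ) = (n ! : ℂ) := by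
      exact_mod_cast Nat.choose_mul_factorial_mul_factorial hi'
    have hfi : iteratedDeriv i f 1 = (i ! : ℂ) * (keiperAlpha i : ℂ) := by
      rw [keiperAlpha_coe, hf_def, iteratedDeriv_const_mul_field]
      have : (i ! : ℂ) ≠ 0 := by exact_mod_cast (Nat.factorial_pos i).ne'
      field_simp
    have hnz : ((n - i)! : ℂ) ≠ 0 := by exact_mod_cast (Nat.factorial_pos (n - i)).ne'
    rw [hfi, ← hchoose]
    field_simp
  rw [sum_congr rfl hfac, ← mul_sum] at hL
  have hn0 : (n ! : ℂ) ≠ 0 := by exact_mod_cast (Nat.factorial_pos n).ne'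
  exact (mul_eq_zero.1 hL.symm).resolve_left hn0

/-- The Taylor coefficients of `1/(2ξ)` at `s = 1` are Keiper's `a_n` (10):
`(1/(2ξ))^{(n)}(1)/n! = a_n`. [cite: Keiper1992, eqs. (9)–(10) p.766] -/
theorem coeff_eq_keiperInvCoeff (n : ℕ) :
    iteratedDeriv n (fun s : ℂ ↦ 1 / (2 * riemannXi s)) 1 / (n ! : ℂ) = (keiperInvCoeff n : ℂ) := by
  induction n using Nat.strong_induction_on with
  | _ n ih =>
    rcases n with _ | n
    · simp [(Keiper1992_eq10 0).1, riemannXi_one]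
    · have h := sum_alpha_mul_coeff_eq_zero (n := n + 1) (by omega)
      rw [sum_range_succ', keiperAlpha_zero, Complex.ofReal_one, one_mul, Nat.sub_zero] at h
      have hS : ∑ i ∈ range (n + 1), (keiperAlpha (i + 1) : ℂ) *
          (iteratedDeriv (n + 1 - (i + 1)) (fun s : ℂ ↦ 1 / (2 * riemannXi s)) 1 /
            ((n + 1 - (i + 1))! : ℂ)) =
          ∑ i ∈ range (n + 1), (keiperAlpha (i + 1) : ℂ) * (keiperInvCoeff (n - i) : ℂ) := by
        refine sum_congr rfl fun i hi ↦ ?_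
        have hi' := mem_range.1 hi
        rw [Nat.add_sub_add_right, ih (n - i) (by omega)]
      rw [hS] at h
      rw [eq_neg_of_add_eq_zero_right h, (Keiper1992_eq10 n).2]
      -- `Σ_{j ∈ [1, n+1]} α_j a_{n+1−j} = Σ_{i<n+1} α_{i+1} a_{n−i}`
      have hIcc : ∀ (G : ℕ → ℝ) (N : ℕ), ∑ k ∈ Icc 1 N, G k = ∑ k ∈ range N, G (k + 1) := by
        intro G N
        induction N with
        | zero => simp
        | succ m ihm => rw [Finset.sum_Icc_succ_top (by omega), ihm, Finset.sum_range_succ]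
      rw [hIcc]
      push_cast
      rfl

end Keiper9

/-- **DISCHARGE of `Keiper1992_eq9`** — [Keiper1992] (9)–(10) p.766: on the disc `|s − 1| < 2`
(`ξ ≠ 0` there), `1/(2ξ(s)) = Σ_{n≥0} a_n (s − 1)^n` with `a_n` the recursively defined
`keiperInvCoeff` of (10): the Taylor series of the holomorphic `1/(2ξ)` converges on the disc
(Mathlib `Complex.hasSum_taylorSeries_on_ball`) and its coefficients obey the recursion (10) by the
Leibniz rule applied to `2ξ · (1/(2ξ)) = 1` (`Keiper9.coeff_eq_keiperInvCoeff`).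
[cite: Keiper1992, eqs. (9)–(10) p.766] -/
theorem Keiper1992_eq9_holds : Keiper1992_eq9 := by
  have hball : Metric.ball (1 : ℂ) 2 ∈ 𝓝 (1 : ℂ) := Metric.ball_mem_nhds _ (by norm_num)
  filter_upwards [hball] with s hs
  have h := Complex.hasSum_taylorSeries_on_ball Keiper9.differentiableOn_inv_two_xi hs
  refine h.congr_fun fun n ↦ ?_
  rw [← Keiper9.coeff_eq_keiperInvCoeff n, smul_eq_mul, smul_eq_mul]
  have hn0 : (n ! : ℂ) ≠ 0 := by exact_mod_cast (Nat.factorial_pos n).ne'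
  field_simp

/-! ## (33) p.768 and (36) p.769: `τ_{m−1}` as a sum over the zeros; the RH bound on `|τ_k|` -/

namespace Keiper33

/-- `|ρ/(ρ − 1)| ≤ 2` for a non-trivial zero (`|Im ρ| > 14`, so `|ρ − 1| ≥ 1` and
`|ρ| ≤ |ρ − 1| + 1 ≤ 2|ρ − 1|`). [cite: Keiper1992, eq. (33) p.768] -/
theorem norm_ratio_le_two (ρ : ZetaZeros.riemannZetaNontrivialZeros) :
    ‖(ρ : ℂ) / ((ρ : ℂ) - 1)‖ ≤ 2 := by
  have h14 : 14 < |(ρ : ℂ).im| := FordL33.fourteen_lt_abs_im ρ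
  have h1 : 1 ≤ ‖(ρ : ℂ) - 1‖ := by
    have := Complex.abs_im_le_norm ((ρ : ℂ) - 1)
    rw [Complex.sub_im, Complex.one_im, sub_zero] at this
    linarith
  have h2 : ‖(ρ : ℂ)‖ ≤ ‖(ρ : ℂ) - 1‖ + 1 := by
    have := norm_add_le ((ρ : ℂ) - 1) 1
    rwa [sub_add_cancel, norm_one] at this
  rw [norm_div, div_le_iff₀ (by linarith)]
  linarith

/-- The algebra of (30)–(33)/(35): with `w = ρ/(ρ − 1)` (so `w − 1 = 1/(ρ − 1)`),
`−w^{n+2} ρ^{−2} = −wⁿ (w − 1)² = (1 − w^{n+2}) − 2(1 − w^{n+1}) + (1 − wⁿ)`.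
[cite: Keiper1992, eqs. (33)–(35) p.768–769] -/
theorem term_identity {ρ : ℂ} (h0 : ρ ≠ 0) (h1 : ρ ≠ 1) (n : ℕ) :
    -(ρ / (ρ - 1)) ^ (n + 2) * (ρ ^ 2)⁻¹ =
      (1 - (ρ / (ρ - 1)) ^ (n + 2)) - 2 * (1 - (ρ / (ρ - 1)) ^ (n + 1)) + (1 - (ρ / (ρ - 1)) ^ n) := by
  have h1' : ρ - 1 ≠ 0 := sub_ne_zero.2 h1
  rw [pow_succ, pow_succ, pow_succ]
  field_simp
  ring

/-- Termwise bound for (33): `|−m(ρ) (ρ/(ρ−1))^m ρ^{−2}| ≤ 2^m · m(ρ)/|ρ|²`. [cite: Keiper1992, eq. (33) p.768] -/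
theorem norm_term_le (m : ℕ) (ρ : ZetaZeros.riemannZetaNontrivialZeros) :
    ‖-(riemannZetaZeroOrder (ρ : ℂ) : ℂ) * ((ρ : ℂ) / ((ρ : ℂ) - 1)) ^ m * ((ρ : ℂ) ^ 2)⁻¹‖ ≤
      (2 : ℝ) ^ m * ((riemannZetaZeroOrder (ρ : ℂ) : ℝ) / ‖(ρ : ℂ)‖ ^ 2) := by
  have hk : (0 : ℝ) < riemannZetaZeroOrder (ρ : ℂ) := FordL33.order_pos ρ
  rw [norm_mul, norm_mul, norm_neg, norm_pow, norm_inv, norm_pow, Complex.norm_intCast,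
    abs_of_pos hk]
  have hw := norm_ratio_le_two ρ
  calc (riemannZetaZeroOrder (ρ : ℂ) : ℝ) * ‖(ρ : ℂ) / ((ρ : ℂ) - 1)‖ ^ m * (‖(ρ : ℂ)‖ ^ 2)⁻¹
      ≤ (riemannZetaZeroOrder (ρ : ℂ) : ℝ) * 2 ^ m * (‖(ρ : ℂ)‖ ^ 2)⁻¹ := by gcongr
    _ = 2 ^ m * ((riemannZetaZeroOrder (ρ : ℂ) : ℝ) / ‖(ρ : ℂ)‖ ^ 2) := by ring

/-- The family of (33), `ρ ↦ −m(ρ) (ρ/(ρ−1))^m ρ^{−2}`, is absolutely summable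
(`|ρ/(ρ−1)| ≤ 2`, `Σ_ρ m(ρ)/|ρ|² < ∞`, tree `FordL33.summable_order_div_norm_sq`).
[cite: Keiper1992, eq. (33) p.768] -/
theorem summable_norm_term (m : ℕ) :
    Summable (fun ρ : ZetaZeros.riemannZetaNontrivialZeros ↦
      ‖-(riemannZetaZeroOrder (ρ : ℂ) : ℂ) * ((ρ : ℂ) / ((ρ : ℂ) - 1)) ^ m * ((ρ : ℂ) ^ 2)⁻¹‖) := by
  have hS : Summable (fun ρ : ZetaZeros.riemannZetaNontrivialZeros ↦
      (2 : ℝ) ^ m * ((riemannZetaZeroOrder (ρ : ℂ) : ℝ) / ‖(ρ : ℂ)‖ ^ 2)) :=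
    FordL33.summable_order_div_norm_sq.mul_left _
  exact hS.of_nonneg_of_le (fun ρ ↦ norm_nonneg _) (norm_term_le m)

/-- The family of (33) is summable. [cite: Keiper1992, eq. (33) p.768] -/
theorem summable_term (m : ℕ) :
    Summable (fun ρ : ZetaZeros.riemannZetaNontrivialZeros ↦
      -(riemannZetaZeroOrder (ρ : ℂ) : ℂ) * ((ρ : ℂ) / ((ρ : ℂ) - 1)) ^ m * ((ρ : ℂ) ^ 2)⁻¹) :=
  (summable_norm_term m).of_norm

/-- `1 − 1/(1 − ρ̄) = conj(ρ/(ρ − 1))`: Li's ratio at the reflected zero `1 − ρ̄` is the conjugate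
of Keiper's ratio at `ρ` (the reindexing between (34) and Li's `λ_m = Σ_ρ[1 − (1 − 1/ρ)^m]`).
[cite: Keiper1992, eq. (34) p.769; Li1997, eq. (1.4)] -/
theorem one_sub_inv_refl {ρ : ℂ} (h1 : ρ ≠ 1) :
    1 - 1 / (1 - conj ρ) = conj (ρ / (ρ - 1)) := by
  have h' : conj ρ - 1 ≠ 0 := by
    rw [sub_ne_zero]
    intro h
    apply h1
    have := congrArg conj h
    simpa using this
  have h'' : 1 - conj ρ ≠ 0 := by
    intro h; apply h'; linear_combination -h
  rw [map_div₀, map_sub, map_one]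
  field_simp
  ring

/-- Keiper's real family: `Σ_ρ m(ρ) Re[1 − (ρ/(ρ−1))^j] = j λ_j` for every `j` ((34) for
`j ≥ 1`, tree `Keiper1992_eq34`; trivial for `j = 0`), as a `HasSum` (absolute convergence
transported from Li's family, tree `summable_keiperLiTerm`, along `ρ ↦ 1 − ρ̄`).
[cite: Keiper1992, eq. (34) p.769] -/
theorem hasSum_re_one_sub_pow (j : ℕ) :
    HasSum (fun ρ : ZetaZeros.riemannZetaNontrivialZeros ↦
      (riemannZetaZeroOrder (ρ : ℂ) : ℝ) * (1 - ((ρ : ℂ) / ((ρ : ℂ) - 1)) ^ j).re)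
      ((j : ℝ) * keiperLambdaK j) := by
  rcases Nat.eq_zero_or_pos j with rfl | hj
  · simp
  -- summability, transported from Li's family along the reflection `ρ ↦ 1 − ρ̄`
  have hLi := summable_keiperLiTerm j
  have hsum : Summable (fun ρ : ZetaZeros.riemannZetaNontrivialZeros ↦
      (riemannZetaZeroOrder (ρ : ℂ) : ℝ) * (1 - ((ρ : ℂ) / ((ρ : ℂ) - 1)) ^ j).re) := by
    have h2 : Summable ((fun ρ : ZetaZeros.riemannZetaNontrivialZeros ↦
        (riemannZetaZeroOrder (ρ : ℂ) : ℝ) * (1 - (1 - 1 / (ρ : ℂ)) ^ j).re) ∘ FordL33.reflEquiv) :=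
      (FordL33.reflEquiv.summable_iff).2 hLi
    refine h2.congr fun ρ ↦ ?_
    simp only [Function.comp_apply]
    rw [FordL33.reflEquiv, Function.Involutive.coe_toPerm, FordL33.order_refl]
    congr 1
    rw [show ((FordL33.refl ρ : RHWave0.riemannZetaNontrivialZeros) : ℂ) = 1 - conj (ρ : ℂ) from rfl,
      one_sub_inv_refl (ZetaZeros.riemannZetaNontrivialZeros.ne_one ρ.2), ← map_pow, ← map_one conj,
      ← map_sub, Complex.conj_re, map_one]
  have hval : ∑' ρ : ZetaZeros.riemannZetaNontrivialZeros,
      (riemannZetaZeroOrder (ρ : ℂ) : ℝ) * (1 - ((ρ : ℂ) / ((ρ : ℂ) - 1)) ^ j).re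
        = (j : ℝ) * keiperLambdaK j := by
    have hj0 : (j : ℝ) ≠ 0 := by exact_mod_cast hj.ne'
    rw [Keiper1992_eq34 hj]
    field_simp
  rw [← hval]
  exact hsum.hasSum

/-- Real part of (33): `Σ_ρ Re[−m(ρ) (ρ/(ρ−1))^m ρ^{−2}] = τ_{m−1}` for `m ≥ 2`, from (34) and the
second-difference formula (35) (tree `Keiper1992_eq35`). [cite: Keiper1992, eqs. (33)–(35) p.768–769] -/
theorem hasSum_re_term {m : ℕ} (hm : 2 ≤ m) :
    HasSum (fun ρ : ZetaZeros.riemannZetaNontrivialZeros ↦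
      (-(riemannZetaZeroOrder (ρ : ℂ) : ℂ) * ((ρ : ℂ) / ((ρ : ℂ) - 1)) ^ m * ((ρ : ℂ) ^ 2)⁻¹).re)
      (keiperTau (m - 1)) := by
  obtain ⟨n, rfl⟩ : ∃ n, m = n + 2 := ⟨m - 2, by omega⟩
  have h35 := Keiper1992_eq35 (m := n + 1) (by omega)
  rw [show n + 1 + 1 = n + 2 from rfl, show n + 1 - 1 = n from rfl] at h35
  have hv : ((n + 2 : ℕ) : ℝ) * keiperLambdaK (n + 2) - 2 * (((n + 1 : ℕ) : ℝ) * keiperLambdaK (n + 1))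
      + (n : ℝ) * keiperLambdaK n = keiperTau (n + 1) := by
    rw [h35]; push_cast; ring
  have H := ((hasSum_re_one_sub_pow (n + 2)).sub ((hasSum_re_one_sub_pow (n + 1)).mul_left 2)).add
    (hasSum_re_one_sub_pow n)
  rw [show n + 2 - 1 = n + 1 from rfl, ← hv]
  refine H.congr_fun fun ρ ↦ ?_
  have h0 : (ρ : ℂ) ≠ 0 := FordL33.coe_ne_zero ρ
  have h1 : (ρ : ℂ) ≠ 1 := ZetaZeros.riemannZetaNontrivialZeros.ne_one ρ.2
  have hre : (-(riemannZetaZeroOrder (ρ : ℂ) : ℂ) * ((ρ : ℂ) / ((ρ : ℂ) - 1)) ^ (n + 2) *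
      ((ρ : ℂ) ^ 2)⁻¹).re = (riemannZetaZeroOrder (ρ : ℂ) : ℝ) *
        ((1 - ((ρ : ℂ) / ((ρ : ℂ) - 1)) ^ (n + 2)) - 2 * (1 - ((ρ : ℂ) / ((ρ : ℂ) - 1)) ^ (n + 1))
          + (1 - ((ρ : ℂ) / ((ρ : ℂ) - 1)) ^ n)).re := by
    rw [← term_identity h0 h1 n, ← Complex.re_ofReal_mul, Complex.ofReal_intCast]
    congr 1
    ring
  rw [hre]
  simp only [Complex.sub_re, Complex.add_re, Complex.mul_re, Complex.re_ofNat, Complex.im_ofNat,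
    zero_mul, sub_zero]
  ring

/-- The sum (33) is self-conjugate (the zero set and the multiplicities are conjugation-symmetric,
tree `ZetaZeros.riemannZetaNontrivialZeros.conj_mem`, `riemannZetaZeroOrder_conj_holds`), hence real
(as it must be: `τ_{m−1}` is real, tree `keiperTau_coe`). [cite: Keiper1992, eq. (33) p.768] -/
theorem conj_tsum_term (m : ℕ) :
    conj (∑' ρ : ZetaZeros.riemannZetaNontrivialZeros,
      -(riemannZetaZeroOrder (ρ : ℂ) : ℂ) * ((ρ : ℂ) / ((ρ : ℂ) - 1)) ^ m * ((ρ : ℂ) ^ 2)⁻¹) =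
    ∑' ρ : ZetaZeros.riemannZetaNontrivialZeros,
      -(riemannZetaZeroOrder (ρ : ℂ) : ℂ) * ((ρ : ℂ) / ((ρ : ℂ) - 1)) ^ m * ((ρ : ℂ) ^ 2)⁻¹ := by
  set c : ZetaZeros.riemannZetaNontrivialZeros → ZetaZeros.riemannZetaNontrivialZeros :=
    fun ρ ↦ ⟨conj (ρ : ℂ), ZetaZeros.riemannZetaNontrivialZeros.conj_mem ρ.2⟩ with hc
  have hinv : Function.Involutive c := fun ρ ↦ Subtype.ext (by simp [hc])
  rw [Complex.conj_tsum]
  refine Eq.trans ?_ (Equiv.tsum_eq (hinv.toPerm c) _)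
  refine tsum_congr fun ρ ↦ ?_
  rw [Function.Involutive.coe_toPerm]
  have hk : riemannZetaZeroOrder (conj (ρ : ℂ)) = riemannZetaZeroOrder (ρ : ℂ) :=
    riemannZetaZeroOrder_conj_holds (ρ : ℂ)
  simp only [hc, map_mul, map_neg, map_pow, map_inv₀, map_div₀, map_sub, map_one, map_intCast, hk]

end Keiper33

/-- **DISCHARGE of `Keiper1992_eq33`** — [Keiper1992] (33) p.768: for `m ≥ 2`,
`τ_{m−1} = −Σ_ρ m(ρ) (ρ/(ρ−1))^m ρ^{−2}` (absolutely convergent sum over the non-trivial zeros with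
multiplicity).  Proof («τ_m is just the second central difference of mλ_m», p.769): the family is
absolutely summable (`Keiper33.summable_term`); with `w = ρ/(ρ−1)`, `−w^m ρ^{−2} = (1 − w^m) −
2(1 − w^{m−1}) + (1 − w^{m−2})`, so its real part sums to `mλ_m − 2(m−1)λ_{m−1} + (m−2)λ_{m−2} =
τ_{m−1}` by (34) (tree `Keiper1992_eq34`) and (35) (tree `Keiper1992_eq35`), while the sum is real by
conjugation symmetry of the zeros. [cite: Keiper1992, eqs. (33)–(35) p.768–769] -/
theorem Keiper1992_eq33_holds : Keiper1992_eq33 := by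
  intro m hm
  have hs := Keiper33.summable_term m
  have h1 := (Complex.hasSum_re hs.hasSum).unique (Keiper33.hasSum_re_term hm)
  have h2 := Complex.conj_eq_iff_im.1 (Keiper33.conj_tsum_term m)
  have h3 : ∑' ρ : ZetaZeros.riemannZetaNontrivialZeros,
      -(riemannZetaZeroOrder (ρ : ℂ) : ℂ) * ((ρ : ℂ) / ((ρ : ℂ) - 1)) ^ m * ((ρ : ℂ) ^ 2)⁻¹ =
        (keiperTau (m - 1) : ℂ) :=
    Complex.ext (by rw [h1, Complex.ofReal_re]) (by rw [h2, Complex.ofReal_im])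
  rw [← h3]
  exact hs.hasSum


namespace Keiper36

/-- Under RH, `|ρ/(ρ − 1)| = 1` for every non-trivial zero (`Re ρ = ½`, so `|ρ − 1| = |ρ|`).
[cite: Keiper1992, eq. (36) p.769] -/
theorem norm_ratio_eq_one (hRH : RiemannHypothesis) (ρ : ZetaZeros.riemannZetaNontrivialZeros) :
    ‖(ρ : ℂ) / ((ρ : ℂ) - 1)‖ = 1 := by
  obtain ⟨hz, hnt⟩ := ρ.2
  have h1 : (ρ : ℂ) ≠ 1 := ZetaZeros.riemannZetaNontrivialZeros.ne_one ρ.2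
  have hρre : (ρ : ℂ).re = 1 / 2 := hRH (ρ : ℂ) hz (fun ⟨k, hk⟩ ↦ hnt ⟨k, hk.symm⟩) h1
  have hρ : 0 < ‖(ρ : ℂ)‖ := norm_pos_iff.2 (FordL33.coe_ne_zero ρ)
  have e2 : ‖(ρ : ℂ) - 1‖ ^ 2 = ‖(ρ : ℂ)‖ ^ 2 := by
    rw [Complex.sq_norm, Complex.sq_norm, Complex.normSq_apply, Complex.normSq_apply]
    simp only [Complex.sub_re, Complex.one_re, Complex.sub_im, Complex.one_im, sub_zero, hρre]
    norm_num
  have e : ‖(ρ : ℂ) - 1‖ = ‖(ρ : ℂ)‖ := (sq_eq_sq₀ (norm_nonneg _) (norm_nonneg _)).1 e2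
  rw [norm_div, e, div_self hρ.ne']

/-- `τ₀ = σ₁ = β/2` ((24) and tree `zetaZeroPowerSum_one`). [cite: Keiper1992, eq. (24) p.768] -/
theorem keiperTau_zero : keiperTau 0 = nicolasBeta / 2 := by
  have h : ((keiperTau 0 : ℝ) : ℂ) = ((nicolasBeta / 2 : ℝ) : ℂ) := by
    rw [Keiper1992_eq24, zetaZeroPowerSum_one]
    push_cast
    ring
  exact_mod_cast h

/-- The case `k = 0` of (36), RH-free: `|τ₀| = Σ_ρ m(ρ) Re ρ/|ρ|² ≤ Σ_ρ m(ρ)/|ρ|²`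
(tree `FordL33.hasSum_zeroOrder_mul_re_div_norm_sq`, `0 < Re ρ < 1`). [cite: Keiper1992, eq. (36) p.769] -/
theorem abs_keiperTau_zero_le :
    |keiperTau 0| ≤ ∑' ρ : ZetaZeros.riemannZetaNontrivialZeros,
      (riemannZetaZeroOrder (ρ : ℂ) : ℝ) / ‖(ρ : ℂ)‖ ^ 2 := by
  have hF : HasSum (fun ρ : ZetaZeros.riemannZetaNontrivialZeros ↦
      (riemannZetaZeroOrder (ρ : ℂ) : ℝ) * ((ρ : ℂ).re / ‖(ρ : ℂ)‖ ^ 2)) (nicolasBeta / 2) :=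
    FordL33.hasSum_zeroOrder_mul_re_div_norm_sq
  have hG : HasSum (fun ρ : ZetaZeros.riemannZetaNontrivialZeros ↦
      (riemannZetaZeroOrder (ρ : ℂ) : ℝ) / ‖(ρ : ℂ)‖ ^ 2) (∑' ρ : ZetaZeros.riemannZetaNontrivialZeros,
        (riemannZetaZeroOrder (ρ : ℂ) : ℝ) / ‖(ρ : ℂ)‖ ^ 2) :=
    FordL33.summable_order_div_norm_sq.hasSum
  have hnn : (0 : ℝ) ≤ nicolasBeta / 2 := by
    have h0 : HasSum (fun _ : ZetaZeros.riemannZetaNontrivialZeros ↦ (0 : ℝ)) 0 := hasSum_zero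
    refine hasSum_le (fun ρ ↦ ?_) h0 hF
    exact mul_nonneg (FordL33.order_pos ρ).le
      (div_nonneg (ZetaZeros.riemannZetaNontrivialZeros.re_pos ρ.2).le (sq_nonneg _))
  have hle : nicolasBeta / 2 ≤ ∑' ρ : ZetaZeros.riemannZetaNontrivialZeros,
      (riemannZetaZeroOrder (ρ : ℂ) : ℝ) / ‖(ρ : ℂ)‖ ^ 2 := by
    refine hasSum_le (fun ρ ↦ ?_) hF hG
    have hk : (0 : ℝ) < riemannZetaZeroOrder (ρ : ℂ) := FordL33.order_pos ρ
    have hre1 := ZetaZeros.riemannZetaNontrivialZeros.re_lt_one ρ.2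
    rw [mul_div_assoc']
    gcongr
    nlinarith
  rw [keiperTau_zero, abs_of_nonneg hnn]
  exact hle

end Keiper36

/-- **DISCHARGE of `Keiper1992_eq36`** — [Keiper1992] (36) p.769: «From (33) it is clear that the
Riemann hypothesis implies that the values of |τ_k| are bounded by Σ_ρ |ρ|^{−2}»: for `k ≥ 1`, (33)
with `m = k + 1` and `|ρ/(ρ−1)| = 1` under RH give `|τ_k| ≤ Σ_ρ m(ρ)/|ρ|²`; for `k = 0`,
`τ₀ = σ₁ = Σ_ρ m(ρ) Re ρ/|ρ|² ≤ Σ_ρ m(ρ)/|ρ|²` ((24), RH-free).  RH-CONSEQUENCE: the hypothesis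
`RiemannHypothesis` is the def's explicit binder; nothing is asserted unconditionally beyond `k = 0`.
[cite: Keiper1992, eq. (36) p.769] -/
theorem Keiper1992_eq36_holds : Keiper1992_eq36 := by
  intro hRH k
  rcases Nat.eq_zero_or_pos k with rfl | hk
  · exact Keiper36.abs_keiperTau_zero_le
  have h33 := Keiper1992_eq33_holds (k + 1) (by omega)
  rw [show k + 1 - 1 = k from rfl] at h33
  have hnorm : ∀ ρ : ZetaZeros.riemannZetaNontrivialZeros,
      ‖-(riemannZetaZeroOrder (ρ : ℂ) : ℂ) * ((ρ : ℂ) / ((ρ : ℂ) - 1)) ^ (k + 1) * ((ρ : ℂ) ^ 2)⁻¹‖ =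
        (riemannZetaZeroOrder (ρ : ℂ) : ℝ) / ‖(ρ : ℂ)‖ ^ 2 := by
    intro ρ
    have hk0 : (0 : ℝ) < riemannZetaZeroOrder (ρ : ℂ) := FordL33.order_pos ρ
    rw [norm_mul, norm_mul, norm_neg, norm_pow, norm_inv, norm_pow, Complex.norm_intCast,
      abs_of_pos hk0, Keiper36.norm_ratio_eq_one hRH ρ, one_pow, mul_one, div_eq_mul_inv]
  calc |keiperTau k| = ‖(keiperTau k : ℂ)‖ := by rw [Complex.norm_real, Real.norm_eq_abs]
    _ = ‖∑' ρ : ZetaZeros.riemannZetaNontrivialZeros,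
          -(riemannZetaZeroOrder (ρ : ℂ) : ℂ) * ((ρ : ℂ) / ((ρ : ℂ) - 1)) ^ (k + 1) *
            ((ρ : ℂ) ^ 2)⁻¹‖ := by rw [h33.tsum_eq]
    _ ≤ ∑' ρ : ZetaZeros.riemannZetaNontrivialZeros,
          ‖-(riemannZetaZeroOrder (ρ : ℂ) : ℂ) * ((ρ : ℂ) / ((ρ : ℂ) - 1)) ^ (k + 1) *
            ((ρ : ℂ) ^ 2)⁻¹‖ := norm_tsum_le_tsum_norm (Keiper33.summable_norm_term (k + 1))
    _ = ∑' ρ : ZetaZeros.riemannZetaNontrivialZeros,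
          (riemannZetaZeroOrder (ρ : ℂ) : ℝ) / ‖(ρ : ℂ)‖ ^ 2 := tsum_congr hnorm

end Literature.NumberTheory.LFunctions

end
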